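import Summits.RiemannHypothesis.RiemannHypothesis.Theorems.TiltedLandingLaw421R3SinkTemplate

/-!
# W-08 · ⟨33346⟩ `TiltedLandingLaw421R`, regime 3′ — «SinkBdry»: the boundary parametrisation of (K∂) in closed form (C1 desk, rh-idea-5 g39)

IMAGE-CAND v1 (token on director-rh's word; files-only · 0 kit · 0 registry verbs · 0 proposals); proposed target
`Summits/RiemannHypothesis/RiemannHypothesis/Theorems/TiltedLandingLaw421R3SinkBdry.lean`, `--supports stmt-RiemannHypothesis-33346 --as helper`.
Sink line; director-rh (CA944)(3) «(a)»: C1 types the BOUNDARY PARAMETRISATION K-lemmas for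
`RhW08.SinkTemplate.CornerDominanceSig` (102 = LAND #1255), C3 g56 keeps the analytic content.  ONE import (tree 102); namespace `RhW08.SinkBdry`;
nothing of 102 re-declared.

WHAT IS HERE (all K = kernel-checked algebra / logic, no analysis):
* §1 the kernels in COORDINATES (via Mathlib's `Complex.inv_re` / `inv_im` and the Literature lemma
  `Literature.NumberTheory.LFunctions.re_one_div_sub`, cited by name; no coordinate lemma re-declared), unconditionally (Lean's `1/0 = 0` makes the
  closed forms exact even at the poles): with `δ = Re w − xv`, `t = Im w`, `ξ = Re u − xv`, `b = Im u`:  `Re K_u(z) = pairReForm (Re z − xv) (Im z) ξ b`,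
  `c(u) = farPairC w u = pairCForm δ t ξ b`, and for the real-part two-point family `N(u) = cutNumer (realTwoPoint xv h y0 w) w u =
  twoPointNForm δ t h y0 ξ b` — explicit rational functions;
* §2 conjugation symmetry `K_{ū} = K_u` (so `N`, `c` are even in `b`) and the BOUNDARY REDUCTION for ANY cut family and `0 ≤ R`:
  `KernelDomBdry xv R cs w σ ↔` four ONE-REAL-VARIABLE families (right column `u = xv + R/2 + i b`, left column `u = xv − R/2 + i b`, `0 ≤ b ≤ R/2`;
  right lid ray `u = xv + ξ + i R/2`, `R/2 ≤ ξ`; left lid ray, `R/2 ≤ −ξ`);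
* §3 the same for `realTwoPoint` IN CLOSED FORM (`BdryDomForm R δ t h y0 σ`), `cornerSigma` in closed form (`cornerSigmaForm`), and the REAL RESTATEMENT
  `CornerDominanceSig ↔ CornerDominanceRealSig` — seven real binders `R s h y0 δ t Y` (`Y = Im v`; `xv` drops out by translation invariance), twelve real
  hypotheses, conclusion `BdryDomForm R δ t h y0 (cornerSigmaForm R δ t h y0)`: C3's pencil proof of corner dominance lands against these named rational
  functions and nothing complex-analytic.

LEVEL: SUPPORT (K).  Asserts no law (`CornerDominanceRealSig` is a `def … : Prop`, equivalent by `cornerDominanceSig_iff` to 102's conjecture, NOT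
proved).  No `sorry`, no new axiom, no `instance` / `notation` / `private` / `set_option`.  Nothing here bears on the truth of RH; RH is not proved;
⟨33346⟩/⟨33347⟩ OPEN; `CornerDominanceSig` / `CertificatesExistSig` OPEN; checked ≠ keyed ≠ landed ≠ proved.
-/

noncomputable section

open Complex
open scoped ComplexConjugate
open RhW08.SinkTemplate

namespace RhW08.SinkBdry

/-! ## §1 The kernels in coordinates -/

/-- CLOSED FORM of `Re K_u(z)` (`K_u(z) = 1/(z − u) + 1/(z − ū)`) in the coordinates `x = Re z − xv`, `t = Im z`, `ξ = Re u − xv`, `b = Im u`. -/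
def pairReForm (x t ξ b : ℝ) : ℝ :=
  (x - ξ) / ((x - ξ) ^ 2 + (t - b) ^ 2) + (x - ξ) / ((x - ξ) ^ 2 + (t + b) ^ 2)

/-- CLOSED FORM of `c(u) = farPairC w u = −Im K_u(w)` in the coordinates `δ = Re w − xv`, `t = Im w`, `ξ = Re u − xv`, `b = Im u`:
`c = (t − b)/((δ − ξ)² + (t − b)²) + (t + b)/((δ − ξ)² + (t + b)²)`. -/
def pairCForm (δ t ξ b : ℝ) : ℝ :=
  (t - b) / ((δ - ξ) ^ 2 + (t - b) ^ 2) + (t + b) / ((δ - ξ) ^ 2 + (t + b) ^ 2)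

/-- CLOSED FORM of the real-part two-point numerator `N(u) = cutNumer (realTwoPoint xv h y0 w) w u = y0·Re K_u(p0) + (1 − y0)·Re K_u(p1) − Re K_u(w)`
(`p0 = xv + i t`, `p1 = xv + i h`, directions `e = −1`) in the coordinates `δ = Re w − xv`, `t = Im w`, `ξ = Re u − xv`, `b = Im u`. -/
def twoPointNForm (δ t h y0 ξ b : ℝ) : ℝ :=
  -(y0 * ξ * (1 / (ξ ^ 2 + (t - b) ^ 2) + 1 / (ξ ^ 2 + (t + b) ^ 2)))
    - (1 - y0) * ξ * (1 / (ξ ^ 2 + (h - b) ^ 2) + 1 / (ξ ^ 2 + (h + b) ^ 2))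
    - (δ - ξ) * (1 / ((δ - ξ) ^ 2 + (t - b) ^ 2) + 1 / ((δ - ξ) ^ 2 + (t + b) ^ 2))

/-- `Re K_u(z)` is `pairReForm` (any axis abscissa `xv`). -/
theorem farPairK_re (u z : ℂ) (xv : ℝ) : (farPairK u z).re = pairReForm (z.re - xv) z.im (u.re - xv) u.im := by
  unfold farPairK pairReForm
  rw [Complex.add_re, Literature.NumberTheory.LFunctions.re_one_div_sub, Literature.NumberTheory.LFunctions.re_one_div_sub,
    Complex.conj_re, Complex.conj_im]
  have e : z.re - xv - (u.re - xv) = z.re - u.re := by ring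
  rw [e, sub_neg_eq_add]

/-- `c(u) = farPairC w u` is `pairCForm` (any axis abscissa `xv`). -/
theorem farPairC_eq (w u : ℂ) (xv : ℝ) : farPairC w u = pairCForm (w.re - xv) w.im (u.re - xv) u.im := by
  -- `Im (1/(z − q))` in coordinates (unconditional; cf. the tree's `RhW08.Lens1ArcSign.im_one_div_sub`, not imported here to keep ONE import)
  have him : ∀ z q : ℂ, (1 / (z - q)).im = -(z.im - q.im) / ((z.re - q.re) ^ 2 + (z.im - q.im) ^ 2) := by
    intro z q
    rw [one_div, Complex.inv_im, Complex.normSq_apply, Complex.sub_re, Complex.sub_im]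
    congr 1
    ring
  unfold farPairC farPairK pairCForm
  rw [Complex.add_im, him, him, Complex.conj_re, Complex.conj_im]
  have e : w.re - xv - (u.re - xv) = w.re - u.re := by ring
  rw [e, sub_neg_eq_add]
  ring

/-- `pairReForm` at the axis (`x = 0`) in product form. -/
theorem pairReForm_zero (t ξ b : ℝ) :
    pairReForm 0 t ξ b = -(ξ * (1 / (ξ ^ 2 + (t - b) ^ 2) + 1 / (ξ ^ 2 + (t + b) ^ 2))) := by
  unfold pairReForm
  rw [zero_sub, neg_sq]
  ring

/-- `pairReForm` in product form. -/
theorem pairReForm_eq (x t ξ b : ℝ) :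
    pairReForm x t ξ b = (x - ξ) * (1 / ((x - ξ) ^ 2 + (t - b) ^ 2) + 1 / ((x - ξ) ^ 2 + (t + b) ^ 2)) := by
  unfold pairReForm
  ring

/-- the two-point numerator `N(u)` of `realTwoPoint xv h y0 w` is `twoPointNForm`. -/
theorem cutNumer_realTwoPoint (xv h y0 : ℝ) (w u : ℂ) :
    cutNumer (realTwoPoint xv h y0 w) w u = twoPointNForm (w.re - xv) w.im h y0 (u.re - xv) u.im := by
  unfold cutNumer realTwoPoint
  rw [Fin.sum_univ_two]
  simp only [Matrix.cons_val_zero, Matrix.cons_val_one, Matrix.cons_val_fin_one, map_neg, map_one, neg_mul, one_mul,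
    Complex.neg_re, Complex.sub_re]
  rw [farPairK_re u w xv, farPairK_re u ⟨xv, w.im⟩ xv, farPairK_re u ⟨xv, h⟩ xv]
  simp only [sub_self]
  rw [pairReForm_zero, pairReForm_zero, pairReForm_eq]
  unfold twoPointNForm
  ring

/-! ## §2 Conjugation symmetry and the boundary reduction (any cut family) -/

variable {κ : Type} [Fintype κ]

/-- `K_{ū} = K_u`. -/
theorem farPairK_conj (u z : ℂ) : farPairK (conj u) z = farPairK u z := by
  unfold farPairK
  rw [Complex.conj_conj, add_comm]

/-- `N(ū) = N(u)` for every cut family. -/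
theorem cutNumer_conj (cs : κ → Cut) (w u : ℂ) : cutNumer cs w (conj u) = cutNumer cs w u := by
  unfold cutNumer
  simp_rw [farPairK_conj]

/-- `c(ū) = c(u)`. -/
theorem farPairC_conj (w u : ℂ) : farPairC w (conj u) = farPairC w u := by
  unfold farPairC
  rw [farPairK_conj]

/-- BOUNDARY REDUCTION (any cut family, `0 ≤ R`): (K∂) holds iff it holds on the four one-real-variable pieces — right / left inner column
`u = xv ± R/2 + i b`, `0 ≤ b ≤ R/2` (the lower halves follow by `K_{ū} = K_u`), and right / left upper lid ray `u = xv + ξ + i R/2`, `R/2 ≤ ±ξ`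
(the lower lid rays again by conjugation). -/
theorem kernelDomBdry_iff (xv R : ℝ) (hR : 0 ≤ R) (cs : κ → Cut) (w : ℂ) (σ : ℝ) :
    KernelDomBdry xv R cs w σ ↔
      (∀ b : ℝ, 0 ≤ b → b ≤ R / 2 → cutNumer cs w ⟨xv + R / 2, b⟩ ≤ σ * farPairC w ⟨xv + R / 2, b⟩) ∧
      (∀ b : ℝ, 0 ≤ b → b ≤ R / 2 → cutNumer cs w ⟨xv - R / 2, b⟩ ≤ σ * farPairC w ⟨xv - R / 2, b⟩) ∧
      (∀ ξ : ℝ, R / 2 ≤ ξ → cutNumer cs w ⟨xv + ξ, R / 2⟩ ≤ σ * farPairC w ⟨xv + ξ, R / 2⟩) ∧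
      (∀ ξ : ℝ, R / 2 ≤ -ξ → cutNumer cs w ⟨xv + ξ, R / 2⟩ ≤ σ * farPairC w ⟨xv + ξ, R / 2⟩) := by
  have hR2 : 0 ≤ R / 2 := by linarith
  constructor
  · intro hK
    refine ⟨fun b hb0 hb1 => hK _ (Or.inl ⟨?_, ?_⟩), fun b hb0 hb1 => hK _ (Or.inl ⟨?_, ?_⟩),
      fun ξ hξ => hK _ (Or.inr ⟨?_, ?_⟩), fun ξ hξ => hK _ (Or.inr ⟨?_, ?_⟩)⟩
    · show |xv + R / 2 - xv| = R / 2
      rw [add_sub_cancel_left, abs_of_nonneg hR2]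
    · show |b| ≤ R / 2
      exact abs_le.2 ⟨by linarith, hb1⟩
    · show |xv - R / 2 - xv| = R / 2
      rw [sub_sub_cancel_left, abs_neg, abs_of_nonneg hR2]
    · show |b| ≤ R / 2
      exact abs_le.2 ⟨by linarith, hb1⟩
    · show R / 2 ≤ |xv + ξ - xv|
      rw [add_sub_cancel_left]
      exact le_abs.2 (Or.inl hξ)
    · show |R / 2| = R / 2
      exact abs_of_nonneg hR2
    · show R / 2 ≤ |xv + ξ - xv|
      rw [add_sub_cancel_left]
      exact le_abs.2 (Or.inr hξ)
    · show |R / 2| = R / 2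
      exact abs_of_nonneg hR2
  · rintro ⟨hC1, hC2, hL1, hL2⟩
    -- first for boundary points in the closed upper half plane
    have key : ∀ u : ℂ, 0 ≤ u.im → MaxStripBdry xv R u → cutNumer cs w u ≤ σ * farPairC w u := by
      intro u hu hB
      rcases hB with ⟨h1, h2⟩ | ⟨h1, h2⟩
      · have hb : u.im ≤ R / 2 := (abs_le.1 h2).2
        rcases (abs_eq hR2).1 h1 with h | h
        · have e : u = ⟨xv + R / 2, u.im⟩ := Complex.ext (by simp; linarith) (by simp)
          rw [e]
          exact hC1 u.im hu hb
        · have e : u = ⟨xv - R / 2, u.im⟩ := Complex.ext (by simp; linarith) (by simp)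
          rw [e]
          exact hC2 u.im hu hb
      · have hb : u.im = R / 2 := by rw [← h2, abs_of_nonneg hu]
        have e : u = ⟨xv + (u.re - xv), R / 2⟩ := Complex.ext (by simp) (by simp [hb])
        rcases le_abs.1 h1 with h | h
        · rw [e]
          exact hL1 (u.re - xv) h
        · rw [e]
          exact hL2 (u.re - xv) h
    intro u hB
    rcases le_or_gt 0 u.im with hu | hu
    · exact key u hu hB
    · have hu' : 0 ≤ (conj u).im := by rw [Complex.conj_im]; linarith
      have hB' : MaxStripBdry xv R (conj u) := by
        unfold MaxStripBdry at hB ⊢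
        rw [Complex.conj_re, Complex.conj_im, abs_neg]
        exact hB
      have := key (conj u) hu' hB'
      rwa [cutNumer_conj, farPairC_conj] at this

/-! ## §3 The real-part two-point family and corner dominance in closed form -/

/-- (K∂) for the two-point family IN CLOSED FORM: the four one-real-variable inequalities between the rational functions `twoPointNForm` and `pairCForm`
(parameters: window `R`, child offset `δ = Re w − xv`, child height `t = Im w`, box top `h`, weight `y0`, multiplier `σ`). -/
def BdryDomForm (R δ t h y0 σ : ℝ) : Prop :=
  (∀ b : ℝ, 0 ≤ b → b ≤ R / 2 → twoPointNForm δ t h y0 (R / 2) b ≤ σ * pairCForm δ t (R / 2) b) ∧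
  (∀ b : ℝ, 0 ≤ b → b ≤ R / 2 → twoPointNForm δ t h y0 (-(R / 2)) b ≤ σ * pairCForm δ t (-(R / 2)) b) ∧
  (∀ ξ : ℝ, R / 2 ≤ ξ → twoPointNForm δ t h y0 ξ (R / 2) ≤ σ * pairCForm δ t ξ (R / 2)) ∧
  (∀ ξ : ℝ, R / 2 ≤ -ξ → twoPointNForm δ t h y0 ξ (R / 2) ≤ σ * pairCForm δ t ξ (R / 2))

/-- `σ*` IN CLOSED FORM: the larger of the two top-corner ratios `N/c` at `ξ = ±R/2`, `b = R/2`. -/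
def cornerSigmaForm (R δ t h y0 : ℝ) : ℝ :=
  max (twoPointNForm δ t h y0 (R / 2) (R / 2) / pairCForm δ t (R / 2) (R / 2))
    (twoPointNForm δ t h y0 (-(R / 2)) (R / 2) / pairCForm δ t (-(R / 2)) (R / 2))

/-- (K∂) for `realTwoPoint xv h y0 w` is `BdryDomForm R (Re w − xv) (Im w) h y0 σ` (`0 ≤ R`). -/
theorem kernelDomBdry_realTwoPoint_iff (xv R h y0 : ℝ) (hR : 0 ≤ R) (w : ℂ) (σ : ℝ) :
    KernelDomBdry xv R (realTwoPoint xv h y0 w) w σ ↔ BdryDomForm R (w.re - xv) w.im h y0 σ := by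
  rw [kernelDomBdry_iff xv R hR]
  unfold BdryDomForm
  simp only [cutNumer_realTwoPoint, farPairC_eq w _ xv, add_sub_cancel_left, sub_sub_cancel_left]

/-- `cornerSigma` of `realTwoPoint xv h y0 w` is `cornerSigmaForm R (Re w − xv) (Im w) h y0`. -/
theorem cornerSigma_realTwoPoint (xv R h y0 : ℝ) (w : ℂ) :
    cornerSigma xv R (realTwoPoint xv h y0 w) w = cornerSigmaForm R (w.re - xv) w.im h y0 := by
  unfold cornerSigma cornerRatio cornerSigmaForm
  simp only [cutNumer_realTwoPoint, farPairC_eq w _ xv, add_sub_cancel_left, sub_sub_cancel_left]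

/-- CORNER DOMINANCE AS A STATEMENT ABOUT REAL RATIONAL FUNCTIONS (equivalent to 102's `CornerDominanceSig` by `cornerDominanceSig_iff`; a CONJECTURE,
not proved here): binders window `R`, state scale `s`, box top `h`, weight `y0`, child offset `δ`, child height `t`, parent height `Y`. -/
def CornerDominanceRealSig : Prop :=
  ∀ (R s h y0 δ t Y : ℝ),
    0 < s → 6 * s ≤ R → 3 * h < R → 0 < Y → Y ≤ h →
    0 < t → t < Y → Y - s / 4 < t → δ ^ 2 + t ^ 2 ≤ Y ^ 2 →
    |δ| * (R - |δ|) < t ^ 2 → 0 ≤ y0 → y0 ≤ 1 →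
    BdryDomForm R δ t h y0 (cornerSigmaForm R δ t h y0)

/-- 102's `CornerDominanceSig` ↔ its real closed form. -/
theorem cornerDominanceSig_iff : CornerDominanceSig ↔ CornerDominanceRealSig := by
  constructor
  · intro hC R s h y0 δ t Y hs hR6 h3 hY hYh ht htY hdrop hnest hcone hy0 hy1
    have hR : 0 ≤ R := by linarith
    have hK := hC 0 R s h y0 ⟨0, Y⟩ ⟨δ, t⟩ hs hR6 h3 rfl hY hYh ht htY hdrop (by simpa using hnest)
      (by simpa [ConeChild] using hcone) hy0 hy1
    rw [kernelDomBdry_realTwoPoint_iff 0 R h y0 hR, cornerSigma_realTwoPoint] at hK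
    simpa using hK
  · intro hReal xv R s h y0 v w hs hR6 h3 _hv hY hYh ht htY hdrop hnest hcone hy0 hy1
    have hR : 0 ≤ R := by linarith
    rw [kernelDomBdry_realTwoPoint_iff xv R h y0 hR, cornerSigma_realTwoPoint]
    exact hReal R s h y0 (w.re - xv) w.im v.im hs hR6 h3 hY hYh ht htY hdrop hnest hcone hy0 hy1

end RhW08.SinkBdry

end
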